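import Summits.BirchSwinnertonDyer.BirchSwinnertonDyer.Theses.ByReductionTypeAtTwo
import Summits.BirchSwinnertonDyer.BirchSwinnertonDyer.Theorems.ByReductionTypeAtTwoRankOneAtTwoOneDoorLawCDefs
import Summits.BirchSwinnertonDyer.BirchSwinnertonDyer.Theorems.ByReductionTypeAtTwoRankOneAtTwoBigImageOddLocalOneDoorFullC
import Summits.BirchSwinnertonDyer.BirchSwinnertonDyer.Theorems.ByReductionTypeAtTwoRankOneAtTwoBigImageOddLocalOneDoorAnalyticAssembly
import Literature.NumberTheory.Automorphic.ShimuraCurveRibetTakahashiOptimalProofs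
import HarnessLib

/-!
# Route ByReductionTypeAtTwo, crux `RankOneAtTwoBigImageOddLocal` (stmt-BirchSwinnertonDyer-23715), LINE v8.4 `one_door_analytic`:
# the MANIN-FREE glue and the crux BY NAME from four stubs

Lead prover seat `bsd-line-fkl-p1` g7 (2026-08-28).  With the door law stated for EVERY parametrisation datum
(`@[conjecture] DoorIndexLawFullCAtTwo`, AN-28c, `…OneDoorLawCDefs.lean`: AN-28 plus the correction `2·v₂(c)`) and its per-datum
equivalence with `BSD₂` (`bsdp_two_iff_doorLawFullC_at`, `…OneDoorFullC.lean`), the glue of LINE v8 no longer needs an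
odd-constant datum: ANY datum at level `N_E` will do, and one exists by modularity alone (tree theorem
`nonempty_modularParametrizationData_iff_exists_isNewformOf_unconditional`, BCDT Thm. A ⟺ `exists_isNewformOf` — the Manin
constant of that datum is whatever it is).  Hence:

* `doorGlueAnC : S_pub → exists_isNewformOf → DoorIndexLawFullCAtTwo → S_rankZeroTwin → DoorSupplyAnalyticAtTwo → S_sliceMW`
  — v8.3's `doorGlueAn` (p617456) WITHOUT its `S_manin` argument; proof = door field from the supply, a datum from modularity,
  `H`, `ι`, the `K`-rational Heegner point (rationality conjunct of `S_pub`, a tree theorem), a minimal twist model `Wd`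
  (non-CM, analytic rank `0`, so `BSD(Wd,2)` from `S_rankZeroTwin`), then the `←` direction of `bsdp_two_iff_doorLawFullC_at`
  (Tamagawa receptacle = the width seat's tree theorem `doorTwistTamagawaAtTwo`, p616165).
* `rankOneAtTwoBigImageOddLocal_of_oneDoorAnalyticC :
    S_pub → S_pubHL → DoorIndexLawFullCAtTwo →
    (GoodOrdinaryRankZeroAtTwo ∧ MultiplicativeRankZeroAtTwo ∧ SupersingularRankZeroAtTwo ∧ AdditiveRankZeroAtTwo) →
    RankOneAtTwoBigImageOddLocal` — the crux BY NAME from the FOUR stubs of skeleton v8.4 (PRINT ×2, AN-28c, the route's own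
  rank-`0` items), composing `doorGlueAnC` with `doorSupplyAnalyticAtTwo_of_pubHL` (p617456) and `bsdp_two_of_rankZero_cruxes`
  (p614641).  Compared with v8.3's `rankOneAtTwoBigImageOddLocal_of_oneDoorAnalytic` (p618446) the argument `S_manin` — i.e.
  `stub_maninPub` (Abbes–Ullmo, Česnavičius) and `stub_maninAdditive` (`@[conjecture] ManinOddAdditiveLevelAtTwo`, the
  `2`-primary Manin conjecture at `4 ∣ N`) — is GONE.

BSD is not proved by any of this: `S_pub` / `S_pubHL` are PRINT named facts (Gross–Zagier, Kolyvagin, GZK, modularity,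
Hoffstein–Luo), `DoorIndexLawFullCAtTwo` is a CONJECTURE (= `BSD₂` of the slice in Heegner-index currency), and the four
`…RankZeroAtTwo` statements are the route's open rank-`0` cruxes.
-/

set_option autoImplicit false

noncomputable section

open scoped Classical

set_option linter.dupNamespace false

namespace Summit.BirchSwinnertonDyer.BirchSwinnertonDyer.Theorems.RankOneAtTwoOneDoor

open WeierstrassCurve NumberField Literature.NumberTheory.EllipticCurves
  Literature.NumberTheory.EllipticCurves.ModularForms
  Summit.BirchSwinnertonDyer.Rank1Residual.F1Sign2
  Summit.BirchSwinnertonDyer.Rank1Residual.F1Sign2.TranspositionDoor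
  Summit.BirchSwinnertonDyer.Rank1Residual
  Summit.BirchSwinnertonDyer.BirchSwinnertonDyer.Theses.ByReductionTypeAtTwo

/-- **The Manin-free glue of LINE v8.4**: published inputs, modularity (for the EXISTENCE of a parametrisation datum, any
constant), the floating-constant door law AN-28c, rank-`0` `BSD₂` for non-CM curves, and the Hoffstein–Luo door supply give
`BSD₂` on the slice (with the Mordell–Weil rank made explicit, as in `S_sliceMW`; that hypothesis is not even used — GZK inside
`bsdp_two_iff_doorLawFullC_at` recovers it). [cite: GrossZagier1986, Thm. I.6.3 and V.§2] -/
theorem doorGlueAnC (hpub : S_pub) (hnf : exists_isNewformOf) (hIdx : DoorIndexLawFullCAtTwo) (hZ : S_rankZeroTwin)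
    (hSup : DoorSupplyAnalyticAtTwo) : S_sliceMW := by
  intro W _ _ hCM hsurj hT hc hr _hrk
  haveI : Fact (Nat.Prime 2) := ⟨Nat.prime_two⟩
  haveI hN : NeZero (W.conductorNorm ℤ) := ⟨(W.conductorNorm_pos_holds).ne'⟩
  -- the door field (Waldspurger–Hoffstein–Luo): admissible, `L(E^{(d_K)},1) ≠ 0`, Heegner
  obtain ⟨K, _iF, _iN, hK, hadm, hLt, -, hHN⟩ := hSup W hr
  -- ANY parametrisation datum at level `N_E` (modularity; its constant is not constrained), `H`, `ι`, the `K`-rational point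
  obtain ⟨Dt⟩ := (nonempty_modularParametrizationData_iff_exists_isNewformOf_unconditional.mpr hnf) W
  obtain ⟨H, -⟩ :=
    nonempty_heegnerDatum_holds (W.conductorNorm ℤ) K hK (exists_dvd_sq_sub_discr_holds (W.conductorNorm ℤ) K hK hHN).choose_spec
  obtain ⟨ι⟩ : Nonempty (K →+* ℂ) := inferInstance
  obtain ⟨hGZ, hKo, hrat⟩ := hpub.1 (W.conductorNorm ℤ) W K
  obtain ⟨P, hP⟩ := hrat hK hHN Dt H ι
  -- a globally minimal model of the twist; it is non-CM of analytic rank `0`, so `BSD(Wd, 2)` by `S_rankZeroTwin`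
  have hD0 : (NumberField.discr K : ℚ) ≠ 0 := by exact_mod_cast NumberField.discr_ne_zero K
  haveI hEt : (W.quadraticTwist (NumberField.discr K : ℚ)).IsElliptic := W.isElliptic_quadraticTwist hD0
  obtain ⟨Cd, hCd⟩ := hasGlobalMinimalModel_rat_holds (W.quadraticTwist (NumberField.discr K : ℚ))
  haveI : (Cd • W.quadraticTwist (NumberField.discr K : ℚ)).IsGloballyMinimal := hCd
  set Wd := Cd • W.quadraticTwist (NumberField.discr K : ℚ) with hWd_def
  have hWd : Cd • W.quadraticTwist (NumberField.discr K : ℚ) = Wd := rfl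
  have hCMd : ¬ Wd.HasCM := RamifiedPairUpperBound.not_hasCM_of_smul_quadraticTwist_eq hD0 hWd hCM
  have hLeq : Wd.entireLFunction = (W.quadraticTwist (NumberField.discr K : ℚ)).entireLFunction := by
    rw [← hWd, entireLFunction_smul]
  have hrd : Wd.analyticRank = 0 :=
    (Wd.analyticRank_eq_zero_iff_holds (hpub.2.2 Wd)).2 (by rw [hLeq]; exact hLt)
  have hBd : BSDp Wd 2 := hZ Wd hCMd hrd
  -- the per-datum equivalence, read from right to left at the law's identity for THIS datum
  obtain ⟨-, -, hiff⟩ :=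
    bsdp_two_iff_doorLawFullC_at hpub.2.1 hpub.2.2 doorTwistTamagawaAtTwo W hT hc hr K hK hGZ hKo hadm hHN hLt Dt H ι P hP
      Wd Cd hWd hBd
  exact hiff.mpr (hIdx W hCM hsurj hT hc hr K hK hadm hLt Dt H ι P hP Wd Cd hWd)

/-- **The crux BY NAME from the four stubs of skeleton v8.4** (`stub_pub`, `stub_pubHL` PRINT · `stub_doorIndexFullC` AN-28c ·
`stub_rankZeroAtTwo` = the route's four rank-`0` items): supply = `doorSupplyAnalyticAtTwo_of_pubHL`, rank-`0` `BSD₂` of non-CM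
curves = `bsdp_two_of_rankZero_cruxes`, glue = `doorGlueAnC`; the Mordell–Weil rank `1` fed to `S_sliceMW` is GZK out of `S_pub`.
[cite: GrossZagier1986, Thm. I.6.3 and V.§2] -/
theorem rankOneAtTwoBigImageOddLocal_of_oneDoorAnalyticC (hpub : S_pub) (hHL : S_pubHL)
    (hIdx : S_pub → DoorIndexLawFullCAtTwo)
    (hZ4 : GoodOrdinaryRankZeroAtTwo ∧ MultiplicativeRankZeroAtTwo ∧ SupersingularRankZeroAtTwo ∧ AdditiveRankZeroAtTwo) :
    RankOneAtTwoBigImageOddLocal := by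
  intro W _ _ hCM hsurj hT hc hr
  have hZ : S_rankZeroTwin := fun V _ _ hVCM hV0 => bsdp_two_of_rankZero_cruxes hZ4 V hVCM hV0
  have hrk : W.mordellWeilRank = 1 := by rw [(hpub.2.1 W (le_of_eq hr)).1, hr]
  exact doorGlueAnC hpub hHL.1 (hIdx hpub) hZ (doorSupplyAnalyticAtTwo_of_pubHL hHL) W hCM hsurj hT hc hr hrk

end Summit.BirchSwinnertonDyer.BirchSwinnertonDyer.Theorems.RankOneAtTwoOneDoor

end
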